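import Summits.Langlands.Langlands.Theses.QuarterDeficit1951
import Summits.Langlands.Langlands.Theorems.QuarterFingerprintDeficit.Negative.QuarterFingerprintDeficitFalseOfEvenIcosahedralMaassFormAt1951

/-!
# `EvenIcosahedralMaassFormAt1951` is exactly what `Langlands` delivers through the route's own dictionary

Companion to the negative lemma `QuarterFingerprintDeficit_false_of_EvenIcosahedralMaassFormAt1951` (line `Sketch`,
crux stmt-Langlands-15897): the construction hypothesis H = `EvenIcosahedralMaassFormAt1951` follows from the
summit statement `Langlands` together with the route's two dictionary items `CorrespondentFingerprint` (C2a) and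
`IcosahedralSupply` (C2b) — the first four lines of the route's deciding theorem `closes`. Hence, GIVEN C2a and C2b,
refuting the crux C1 through H and proving H are the same task as verifying Langlands' prediction at conductor
1951: the route's `closes` factors as `(H → ¬C1) ∘ (Langlands → H)` (we do not restate that composite here).
-/

set_option linter.dupNamespace false

namespace Summit.Langlands.Langlands.Theorems.QuarterFingerprintDeficit.Negative

open Summit.Langlands.Langlands.Theses.QuarterDeficit1951

/-- **Langlands ⇒ H (given the route's dictionary).** From `Langlands` (conjunct (B) at `F = ℚ`, `n = 2`),
`IcosahedralSupply` (a Doud–Moore even icosahedral `ρ` of conductor 1951 at `ℓ = 17`) and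
`CorrespondentFingerprint` (its cuspidal correspondent is a fingerprinted `λ = 1/4` Maass newform on
`(Γ₀(1951), χ)`, `χ` of order 5) one gets `EvenIcosahedralMaassFormAt1951` verbatim. Same first four lines as the
route's `closes`. [folklore] -/
theorem evenIcosahedralMaassFormAt1951_of_langlands (h₂ : CorrespondentFingerprint) (h₃ : IcosahedralSupply)
    (hL : _root_.Langlands) : EvenIcosahedralMaassFormAt1951 := by
  -- buildfix 2026-08-20 (proof-only): since the ∀𝓡 re-type of the summit (2026-08-17) `Langlands` gives
  -- `Nonempty (ReciprocityData ℚ)` and the correspondence for EVERY reciprocity datum.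
  obtain ⟨⟨RD⟩, hRD⟩ := hL ℚ
  haveI : Fact (Nat.Prime 17) := ⟨by norm_num⟩
  obtain ⟨ι, ρ, hgeo, hyp⟩ := h₃ RD 17 le_rfl
  have hB := (hRD RD 2 (by norm_num)
    (Literature.NumberTheory.Automorphic.isCompact_glFiniteIntegralLevel_holds 2 ℚ)).2
  obtain ⟨π, hLalg, hcorr⟩ := hB 17 ι ρ hyp.1 hgeo
  obtain ⟨χ, hχ, u, hform, hne, hfp⟩ := h₂ RD 17 ι _ π ρ le_rfl (by norm_num) hyp hLalg hcorr
  exact ⟨χ, hχ, u, hform, hne, hfp⟩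

end Summit.Langlands.Langlands.Theorems.QuarterFingerprintDeficit.Negative
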